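import Mathlib
import Literature.Geometry.Lorentzian.KerrConvergence
import Literature.Geometry.Lorentzian.TameChartCompactness
import Literature.Geometry.Lorentzian.CurvatureNaturality
import Literature.Geometry.Lorentzian.ImmersionChartMetric
import Literature.Geometry.Lorentzian.ChartConnection
import Literature.Geometry.Lorentzian.OpensChartGeodesicODE
import Literature.Geometry.Lorentzian.NonImprisonmentProofs
import Literature.Geometry.Lorentzian.CauchyDevelopmentGlobalHyperbolicityProofs
import Literature.Geometry.Lorentzian.LeviCivitaProofs
import Summits.FinalStateConjecture.FinalStateConjecture.Theorems.PhotonSphereChannelsTameCensorshipForcedSpeed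
import Summits.FinalStateConjecture.FinalStateConjecture.Theorems.PhotonSphereChannelsTameCensorshipCausalCurveTail
import Summits.FinalStateConjecture.FinalStateConjecture.Theorems.PhotonSphereChannelsTameCensorshipChristoffelBound
import Summits.FinalStateConjecture.FinalStateConjecture.Theorems.PhotonSphereChannelsTameCensorshipMaximalGeodesicEndless
import Summits.FinalStateConjecture.FinalStateConjecture.Theorems.PhotonSphereChannelsTameCensorshipChartRiemannBound
import Summits.FinalStateConjecture.FinalStateConjecture.Theorems.PhotonSphereChannelsTameCensorshipChartGeodesic
import Summits.FinalStateConjecture.FinalStateConjecture.Theorems.PhotonSphereChannelsTameCensorshipChartBounds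
import Summits.FinalStateConjecture.FinalStateConjecture.Theorems.PhotonSphereChannelsTameCensorshipPancakeGlue

/-!
# Route PhotonSphereChannels · crux `TameCensorship` (stmt-FinalStateConjecture-17431) · line `Sketch`, skeleton v6 ·
# THE PANCAKE LAW, TAIL FORM — the (ii) ⇒ tame-tail lever of the alternative route to clause (a), ASSEMBLED

Closing file of the pancake-law bricks (lead c2, 2026-08-17; `--supports stmt-FinalStateConjecture-17431`, registered as
`stub_pancakeLawTail`). In a Cauchy development whose outer region `J⁺(ιΣ) ∩ {visible}` is covered by uniformly tame late
charts from the coordinate ball `B(0, r₀) ⊆ E4` (`C³` deviation `≤ Λ`, `C⁰` deviation `≤ ½`; clause (ii) of K3 for this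
development, verbatim), every VISIBLE FUTURE-INCOMPLETE NULL GEODESIC `γ` (maximal geodesic on an interval `dom ∋ 0`
bounded above, null future-directed velocity, visible from `t ≥ 0`) has a TAME TAIL: from some `t₁ ∈ dom` on, null
frames `f` at `γ t` adapted to `γ' t` and boost parameters `u ≥ (C (sSup dom − t))⁻¹` with
`|R(f_a, f_b, f_c, f_d)| ≤ C · u ^ (#ℓ-slots − #n-slots)`, one constant `C = C(Λ, r₀) > 0` for the whole tail.

Proof (the forced-boost argument): the ray is future-endless on every final segment (`stub_maximalGeodesic_isFutureEndless`),
so its tail enters `J⁺(ιΣ)` (`stub_causalCurve_eventually_mem_causalFuture`) and every tail point carries a tame chart `Ψ`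
centred at it; by non-imprisonment (`CauchyDevelopment.isStronglyCausal`, `IsStronglyCausal.exists_forall_notMem`) the ray
leaves the compact image of the closed half-ball, at a first exit time `T < sSup dom` (`exists_first_exit`); inside the chart
it is a geodesic of `Ψ^* g` (`stub_chartGeodesic_of_injective`) obeying `x'' = −Γ(x', x')` (`OpensChart.hasDerivAt_of_isGeodesicOn`)
with `‖Γ‖ ≤ 3Λ` (`stub_christoffelBound`, components and bounds from `…ChartBounds`), so its chart speed at the centre is
`u ≥ (1 − e^{−K r₀/2}) / (K (T − t))` (`stub_forcedSpeed`, `K = 3Λ + 1`); the adapted frame under the pin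
(`adaptedNullFrame_of_pin`: `‖n‖ u ≤ 24`, `‖e_A‖ ≤ 74`) pushed forward by `dΨ`, the chart curvature bound
`|R| ≤ (3Λ + 27Λ²) ∏‖·‖` (`stub_chartRiemannBound`) and naturality (`val_riemann_immersionChart`) give the table
(`table_bound`) with `C = max (C_R · 74⁴) (1/c₁) ∨ 1`.

References: B. O'Neill, *Semi-Riemannian Geometry* (1983), Ch. 3 (Prop. 3.13, Lemma 3.38, Prop. 3.59), Ch. 5
(Lemma 8, Lemma 26), Ch. 14 (Lemma 13, Lemma 29); S. W. Hawking, G. F. R. Ellis (1973), §6.4, §8.1.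
-/
set_option linter.dupNamespace false
set_option maxSynthPendingDepth 3

open Literature.Geometry.Lorentzian
open scoped Manifold ContDiff Topology
open Set Filter TopologicalSpace

noncomputable section

namespace Summit.FinalStateConjecture.FinalStateConjecture.Theorems.PhotonSphereChannels.TameCensorshipUnwind

/-! ## The assembly -/

/-- `C^∞ = C^{∞+1}` for the smoothness exponent of the chart. -/
theorem infty_add_one_eq : (∞ : ℕ∞ω) + 1 = ∞ := by
  show ((⊤ : ℕ∞) : ℕ∞ω) + 1 = ((⊤ : ℕ∞) : ℕ∞ω)
  rw [← WithTop.coe_one, ← WithTop.coe_add, WithTop.coe_eq_coe]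
  exact top_add _

/-- A late chart of the Minkowski background on a coordinate ball is an open embedding of the whole ball (its late
region after time `−r₀` is the whole ball). [folklore] -/
theorem isOpenEmbedding_of_isLateChart_ball {𝓢 : Spacetime.{0} 4} {r₀ : ℝ} {𝒟 : Set 𝓢.carrier}
    {Ψ : (⟨Metric.ball (0 : E4) r₀, Metric.isOpen_ball⟩ : Opens E4) → 𝓢.carrier}
    (hΨ : 𝓢.IsLateChart (Minkowski.backgroundOn ⟨Metric.ball (0 : E4) r₀, Metric.isOpen_ball⟩) 𝒟 (-r₀) Ψ) :
    Topology.IsOpenEmbedding Ψ := by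
  have h := hΨ.isOpenEmbedding
  have hS := Minkowski.lateRegion_backgroundOn_ball_eq_univ r₀
  refine Topology.IsOpenEmbedding.of_continuous_injective_isOpenMap hΨ.contMDiff.continuous
    (Spacetime.injective_of_isLateChart_ball hΨ) fun V hV ↦ ?_
  have h1 := h.isOpenMap _ (hV.preimage continuous_subtype_val)
  have h2 : ((Minkowski.backgroundOn ⟨Metric.ball (0 : E4) r₀, Metric.isOpen_ball⟩).lateRegion (-r₀)).restrict Ψ ''
      (Subtype.val ⁻¹' V) = Ψ '' V := by
    ext z
    simp only [mem_image, mem_preimage, Set.restrict_apply]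
    constructor
    · rintro ⟨⟨w, hwS⟩, hw, rfl⟩
      exact ⟨w, hw, rfl⟩
    · rintro ⟨w, hw, rfl⟩
      exact ⟨⟨w, by rw [hS]; trivial⟩, hw, rfl⟩
  convert h1 using 1
  exact h2.symm

set_option maxHeartbeats 800000 in
/-- **PANCAKE LAW, TAIL FORM (def-free statement)**: in a Cauchy development whose outer region
`J⁺(ιΣ) ∩ {visible}` is covered by uniformly tame late charts from the coordinate ball of radius `r₀` (`C³` deviation
`≤ Λ`, `C⁰` deviation `≤ ½`) — clause (ii) of K3 for this development — every visible future-incomplete null geodesic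
`γ` (maximal geodesic on `dom ∋ 0`, `dom` bounded above, null future-directed velocity, visible from `t ≥ 0`) has a
TAME TAIL: from some `t₁ ∈ dom` on there are adapted null frames `f` at `γ t` with `f 0 = γ' t` and boost parameters
`u ≥ (C (sSup dom − t))⁻¹` such that `|R(f_a, f_b, f_c, f_d)| ≤ C u ^ (#ℓ-slots − #n-slots)`, one constant `C > 0` for
the whole tail. -/
theorem stub_pancakeLawTail :
    ∀ (X : Type) [TopologicalSpace X] [ChartedSpace E3 X] [IsManifold (𝓡 3) ∞ X] [T2Space X]
    [SecondCountableTopology X] [ConnectedSpace X],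
    ∀ (D : InitialDataSet (𝓡 3) X) (𝒟 : CauchyDevelopment D), ∀ [𝒟.metric.HasLeviCivita],
    (∀ [𝒟.metric.HasLeviCivita],
      ∃ r₀ : ℝ, 0 < r₀ ∧ ∃ Λ : NNReal, ∀ q ∈ 𝒟.metric.causalFuture 𝒟.timeOrientation (Set.range 𝒟.embed) ∩
          {q | ∃ (p : X) (γ : ℝ → 𝒟.carrier) (dom : Set ℝ),
            𝒟.metric.IsNormalisedNullRayFrom 𝒟.timeOrientation 𝒟.embed 𝒟.normal p γ dom ∧
              ¬ BddAbove dom ∧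
                q ∈ 𝒟.metric.chronologicalPast 𝒟.timeOrientation (γ '' (dom ∩ Set.Ici 0))},
        ∃ Ψ : (⟨Metric.ball (0 : E4) r₀, Metric.isOpen_ball⟩ : TopologicalSpace.Opens E4) → 𝒟.carrier,
          𝒟.toSpacetime.IsLateChart
              (Minkowski.backgroundOn (⟨Metric.ball (0 : E4) r₀, Metric.isOpen_ball⟩ : TopologicalSpace.Opens E4))
              Set.univ (-r₀) Ψ ∧
            (∃ x : (⟨Metric.ball (0 : E4) r₀, Metric.isOpen_ball⟩ : TopologicalSpace.Opens E4),
                (x : E4) = 0 ∧ Ψ x = q) ∧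
              supCkENorm (((⟨Metric.ball (0 : E4) r₀, Metric.isOpen_ball⟩ : TopologicalSpace.Opens E4)) : Set E4) 3
                  (𝒟.toSpacetime.deviationExtend
                    (Minkowski.backgroundOn (⟨Metric.ball (0 : E4) r₀, Metric.isOpen_ball⟩ : TopologicalSpace.Opens E4))
                    Ψ) ≤ (Λ : ENNReal) ∧
                supCkENorm (((⟨Metric.ball (0 : E4) r₀, Metric.isOpen_ball⟩ : TopologicalSpace.Opens E4)) : Set E4) 0
                  (𝒟.toSpacetime.deviationExtend
                    (Minkowski.backgroundOn (⟨Metric.ball (0 : E4) r₀, Metric.isOpen_ball⟩ : TopologicalSpace.Opens E4))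
                    Ψ) ≤ 1 / 2) →
    ∀ (γ : ℝ → 𝒟.carrier) (dom : Set ℝ),
    (IsMaximalGeodesicOn 𝒟.metric.leviCivita γ dom ∧ (0 : ℝ) ∈ dom ∧ BddAbove dom ∧
      (∀ t ∈ dom, 𝒟.metric.IsNull (velocity (𝓡 4) γ t) ∧
        𝒟.timeOrientation.IsFutureDirected (velocity (𝓡 4) γ t)) ∧
      (∀ t ∈ dom, 0 ≤ t → (∃ (p : X) (δ : ℝ → 𝒟.carrier) (s : Set ℝ),
        𝒟.metric.IsNormalisedNullRayFrom 𝒟.timeOrientation 𝒟.embed 𝒟.normal p δ s ∧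
          ¬ BddAbove s ∧
            γ t ∈ 𝒟.metric.chronologicalPast 𝒟.timeOrientation (δ '' (s ∩ Set.Ici 0))))) →
    ∃ t₁ ∈ dom, ∃ C : ℝ, 0 < C ∧ ∀ t ∈ dom, t₁ ≤ t →
      ∃ f : Fin 4 → TangentSpace (𝓡 4) (γ t),
        (f 0 = velocity (𝓡 4) γ t ∧ 𝒟.metric.val (γ t) (f 0) (f 0) = 0 ∧ 𝒟.metric.val (γ t) (f 1) (f 1) = 0 ∧
          𝒟.metric.val (γ t) (f 0) (f 1) = -1 ∧
          𝒟.metric.val (γ t) (f 2) (f 2) = 1 ∧ 𝒟.metric.val (γ t) (f 3) (f 3) = 1 ∧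
          𝒟.metric.val (γ t) (f 2) (f 3) = 0 ∧
          𝒟.metric.val (γ t) (f 0) (f 2) = 0 ∧ 𝒟.metric.val (γ t) (f 0) (f 3) = 0 ∧
          𝒟.metric.val (γ t) (f 1) (f 2) = 0 ∧ 𝒟.metric.val (γ t) (f 1) (f 3) = 0) ∧
        ∃ u : ℝ, (C * (sSup dom - t))⁻¹ ≤ u ∧
          ∀ a b c d : Fin 4,
            |𝒟.metric.val (γ t)
                (CovariantDerivative.curvature 𝒟.metric.leviCivita (γ t) (f a) (f b) (f c)) (f d)| ≤
              C * u ^ ((if a = 0 then 1 else if a = 1 then -1 else 0 : ℤ) +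
                (if b = 0 then 1 else if b = 1 then -1 else 0 : ℤ) +
                (if c = 0 then 1 else if c = 1 then -1 else 0 : ℤ) +
                (if d = 0 then 1 else if d = 1 then -1 else 0 : ℤ)) := by
  intro X _ _ _ _ _ _ D 𝒟 _ hT γ dom hvis
  obtain ⟨hmax, h0, hbdd, hnull, hvisib⟩ := hvis
  obtain ⟨r₀, hr₀, Λ, hcharts⟩ := hT
  -- the ray as a causal curve; future-endless on every final segment (stub 14)
  have hgeo : IsGeodesicOn 𝒟.metric.leviCivita γ dom := hmax.isGeodesicOn
  have hopen : IsOpen dom := hmax.isOpen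
  have hord : dom.OrdConnected := hmax.2.1
  have hcont : ∀ s ∈ dom, ContinuousAt γ s := fun s hs ↦
    (IsGeodesicOn.mdifferentiableAt_holds hgeo hs).continuousAt
  have hcausal : ∀ t₀ : ℝ, 𝒟.metric.IsFutureCausalCurveOn 𝒟.timeOrientation γ (dom ∩ Ici t₀) :=
    fun t₀ s hs ↦ ⟨IsGeodesicOn.mdifferentiableAt_holds hgeo hs.1, (hnull s hs.1).2⟩
  have hendless : ∀ t₀ ∈ dom, IsFutureEndless γ (dom ∩ Ici t₀) := fun t₀ ht₀ ↦
    stub_maximalGeodesic_isFutureEndless 𝒟.toSpacetime γ dom t₀ hmax hbdd ht₀ (hnull t₀ ht₀).1.2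
  -- the tail enters `J⁺(ιΣ)` (stub 15)
  obtain ⟨t₁, ⟨ht₁dom, ht₁0⟩, hJ⟩ := stub_causalCurve_eventually_mem_causalFuture X D 𝒟 γ (dom ∩ Ici 0)
    (hord.inter ordConnected_Ici) (hcausal 0) (hendless 0 h0)
  -- the constants of the tail (depend on `Λ`, `r₀` only)
  set Λr : ℝ := (Λ : ℝ) with hΛr
  have hΛr0 : 0 ≤ Λr := Λ.coe_nonneg
  set K : ℝ := 3 * Λr + 1 with hK
  have hKpos : 0 < K := by positivity
  set c₁ : ℝ := (1 - Real.exp (-(K * (r₀ / 2)))) / K with hc₁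
  have hc₁pos : 0 < c₁ := by
    have : Real.exp (-(K * (r₀ / 2))) < 1 := by
      rw [← Real.exp_zero]
      exact Real.exp_lt_exp.mpr (by nlinarith)
    exact div_pos (by linarith) hKpos
  set CR : ℝ := 3 * Λr + 3 * (3 * Λr) ^ 2 with hCR
  have hCR0 : 0 ≤ CR := by positivity
  set C : ℝ := max (max (CR * 74 ^ 4) c₁⁻¹) 1 with hC
  have hC1 : 1 ≤ C := le_max_right _ _
  have hCpos : 0 < C := lt_of_lt_of_le one_pos hC1
  have hCR_le : CR * 74 ^ 4 ≤ C := (le_max_left _ _).trans (le_max_left _ _)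
  have hc₁_le : c₁⁻¹ ≤ C := (le_max_right _ _).trans (le_max_left _ _)
  refine ⟨t₁, ht₁dom, C, hCpos, fun t ht ht₁t ↦ ?_⟩
  have h0t : (0 : ℝ) ≤ t := le_trans ht₁0 ht₁t
  -- the tail point is in `outer`, hence carries a tame chart
  have hq : γ t ∈ 𝒟.metric.causalFuture 𝒟.timeOrientation (Set.range 𝒟.embed) ∩
      {q | ∃ (p : X) (γ : ℝ → 𝒟.carrier) (dom : Set ℝ),
        𝒟.metric.IsNormalisedNullRayFrom 𝒟.timeOrientation 𝒟.embed 𝒟.normal p γ dom ∧ ¬ BddAbove dom ∧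
          q ∈ 𝒟.metric.chronologicalPast 𝒟.timeOrientation (γ '' (dom ∩ Set.Ici 0))} :=
    ⟨hJ t ⟨ht, h0t⟩ ht₁t, hvisib t ht h0t⟩
  set Uo : Opens E4 := ⟨Metric.ball (0 : E4) r₀, Metric.isOpen_ball⟩ with hUo
  obtain ⟨Ψ, hlate, ⟨x₀, hx₀0, hΨx₀⟩, hΛ3, hhalf⟩ := hcharts (γ t) hq
  -- smoothness, pin, immersion, embedding
  have hΨs : ContMDiff 𝓘(ℝ, E4) (𝓡 4) (∞ + 1) Ψ := by rw [infty_add_one_eq]; exact hlate.contMDiff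
  have hpinG : ∀ y : Uo, ‖(𝒟.toSpacetime.deviationExtend (Minkowski.backgroundOn Uo) Ψ y + Minkowski.bilin) -
      Minkowski.bilin‖ ≤ 1 / 2 := fun y ↦ norm_components_sub_bilin_le 𝒟.toSpacetime Uo Ψ y.2 hhalf
  have hdev : ∀ y : Uo, ‖𝒟.toSpacetime.deviation (Minkowski.backgroundOn Uo) Ψ y‖ ≤ 1 / 2 := fun y ↦ by
    have h := hpinG y
    rw [add_sub_cancel_right] at h
    have e : 𝒟.toSpacetime.deviationExtend (Minkowski.backgroundOn Uo) Ψ (y : E4) =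
        𝒟.toSpacetime.deviation (Minkowski.backgroundOn Uo) Ψ y :=
      Spacetime.deviationExtend_coe 𝒟.toSpacetime (Minkowski.backgroundOn Uo) Ψ y
    rwa [e] at h
  have hΨ' : ∀ u, Function.Injective (mfderiv 𝓘(ℝ, E4) (𝓡 4) Ψ u) := fun u ↦
    injective_mfderiv_of_deviation_le 𝒟.toSpacetime Uo Ψ u (hdev u)
  have hinjΨ : Function.Injective Ψ := Spacetime.injective_of_isLateChart_ball hlate
  have hemb : Topology.IsOpenEmbedding Ψ := isOpenEmbedding_of_isLateChart_ball hlate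
  -- the transported metric and its components
  set gU := ImmersionChart.metric 𝒟.metric.toPseudoRiemannianMetric hΨs hΨ' rfl with hgU
  haveI : gU.HasLeviCivita := gU.hasLeviCivita
  set G : E4 → E4 →L[ℝ] E4 →L[ℝ] ℝ := fun z ↦
    𝒟.toSpacetime.deviationExtend (Minkowski.backgroundOn Uo) Ψ z + Minkowski.bilin with hGdef
  have hG : ∀ y : Uo, gU.val y = G y := fun y ↦
    immersionChart_metric_val_eq_deviationExtend_add 𝒟.toSpacetime Uo Ψ hΨs hΨ' rfl y
  have hD1 : ∀ y : Uo, ∀ v : E4, ‖fderiv ℝ G y v‖ ≤ Λr * ‖v‖ := fun y v ↦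
    norm_fderiv_components_le 𝒟.toSpacetime Uo Ψ y.2 hΛ3 v
  have hD2 : ∀ y : Uo, ∀ v w : E4, ‖fderiv ℝ (fderiv ℝ G) y v w‖ ≤ Λr * ‖v‖ * ‖w‖ := fun y v w ↦
    norm_fderiv_fderiv_components_le 𝒟.toSpacetime Uo Ψ y.2 hΛ3 v w
  have hΓ : ∀ y : Uo, ∀ Y X : E4, ‖OpensChart.christoffel gU G y Y X‖ ≤ 3 * Λr * ‖Y‖ * ‖X‖ := fun y ↦
    stub_christoffelBound Uo gU G y Λr hG (hpinG y) (hD1 y)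
  have hRb : ∀ y : Uo, ∀ a b c e : E4, |gU.val y (gU.riemann y a b c) e| ≤ CR * ‖a‖ * ‖b‖ * ‖c‖ * ‖e‖ :=
    fun y ↦ stub_chartRiemannBound Uo gU G y Λr (3 * Λr) hG (hpinG y) (hD2 y) (by positivity) (hΓ y)
  have hGd : ∀ y : Uo, DifferentiableAt ℝ G y := fun y ↦
    (OpensChart.contDiffAt_repr hG y).differentiableAt (by simp)
  -- half balls; the ray leaves the compact image of the closed half ball (non-imprisonment)
  set Bh : Set Uo := {w | ‖(w : E4)‖ < r₀ / 2} with hBh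
  set Bc : Set Uo := {w | ‖(w : E4)‖ ≤ r₀ / 2} with hBc
  have hBhc : Bh ⊆ Bc := fun w hw ↦ show ‖(w : E4)‖ ≤ r₀ / 2 from le_of_lt hw
  have hBh_open : IsOpen Bh := isOpen_lt continuous_subtype_val.norm continuous_const
  have hO'open : IsOpen (Ψ '' Bh) := hemb.isOpenMap _ hBh_open
  have hBc_cpt : IsCompact Bc := by
    rw [Topology.IsEmbedding.subtypeVal.isCompact_iff]
    have e : (Subtype.val '' Bc : Set E4) = Metric.closedBall 0 (r₀ / 2) := by
      ext z
      simp only [mem_image, Metric.mem_closedBall, dist_zero_right]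
      constructor
      · rintro ⟨w, hw, rfl⟩; exact hw
      · intro hz
        have hzU : z ∈ Uo := by
          show z ∈ Metric.ball (0 : E4) r₀
          rw [Metric.mem_ball, dist_zero_right]; linarith
        exact ⟨⟨z, hzU⟩, hz, rfl⟩
    rw [e]
    exact isCompact_closedBall 0 (r₀ / 2)
  have hKc : IsCompact (Ψ '' Bc) := hBc_cpt.image hemb.continuous
  have hn2 : (2 : ℕ∞ω) ≤ ∞ := WithTop.coe_le_coe.mpr le_top
  obtain ⟨s₂, ⟨hs₂dom, hts₂⟩, hleave⟩ := LorentzianMetric.IsStronglyCausal.exists_forall_notMem hn2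
    𝒟.isStronglyCausal hKc (hord.inter ordConnected_Ici) (hcausal t) (hendless t ht)
  have hγs₂ : γ s₂ ∉ Ψ '' Bh := fun h ↦ hleave s₂ ⟨hs₂dom, hts₂⟩ le_rfl (image_mono hBhc h)
  have hγt : γ t ∈ Ψ '' Bh := by
    refine ⟨x₀, ?_, hΨx₀⟩
    show ‖(x₀ : E4)‖ < r₀ / 2
    rw [hx₀0, norm_zero]; positivity
  obtain ⟨T, hTdom, htT, -, hin, hout, hcl⟩ := exists_first_exit hord hcont hO'open ht hs₂dom hts₂ hγt hγs₂
  have hγT : γ T ∈ Ψ '' Bc := closure_minimal (image_mono hBhc) hKc.isClosed hcl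
  -- the chart curve
  classical
  set x : ℝ → Uo := fun s ↦ if h : γ s ∈ Set.range Ψ then h.choose else x₀ with hxdef
  have hxΨ : ∀ s, γ s ∈ Set.range Ψ → Ψ (x s) = γ s := fun s h ↦ by
    simp only [hxdef, dif_pos h]; exact h.choose_spec
  set O : Set ℝ := dom ∩ γ ⁻¹' (Set.range Ψ) with hO
  have hOopen : IsOpen O :=
    (continuousOn_of_forall_continuousAt hcont).isOpen_inter_preimage hopen hemb.isOpen_range
  have hIccO : Icc t T ⊆ O := by
    intro s hs
    refine ⟨hord.out ht hTdom hs, ?_⟩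
    rcases hs.2.eq_or_lt with h | h
    · rw [h]; exact image_subset_range _ _ hγT
    · exact image_subset_range _ _ (hin s ⟨hs.1, h⟩)
  have htO : t ∈ O := hIccO (left_mem_Icc.2 htT.le)
  obtain ⟨hxgeo, hvel⟩ := stub_chartGeodesic_of_injective 𝒟.toSpacetime Uo Ψ hΨs hΨ' rfl hinjΨ γ x O hOopen
    (hgeo.mono inter_subset_left) (fun s hs ↦ hxΨ s hs.2)
  -- the geodesic equation in the chart and the forced speed
  have hode := fun s (hs : s ∈ O) ↦ OpensChart.hasDerivAt_of_isGeodesicOn hG hGd hxgeo hs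
  set vel : ℝ → E4 := fun s ↦ (velocity 𝓘(ℝ, E4) x s : E4) with hveldef
  set acc : ℝ → E4 := fun s ↦ -(OpensChart.christoffel gU G (x s) (vel s) (vel s)) with haccdef
  have hxt0 : ((x t : Uo) : E4) = 0 := by
    have : x t = x₀ := hinjΨ ((hxΨ t htO.2).trans hΨx₀.symm)
    rw [this, hx₀0]
  have hxT : r₀ / 2 ≤ ‖((x T : Uo) : E4)‖ := by
    by_contra hlt
    push Not at hlt
    have hTO : T ∈ O := hIccO (right_mem_Icc.2 htT.le)
    exact hout ⟨x T, hlt, hxΨ T hTO.2⟩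
  have hspeed := stub_forcedSpeed E4 (fun s ↦ ((x s : Uo) : E4)) vel acc K (r₀ / 2) t T hKpos htT
    (fun s hs ↦ (hode s (hIccO hs)).1) (fun s hs ↦ (hode s (hIccO hs)).2)
    (fun s hs ↦ by
      show ‖-(OpensChart.christoffel gU G (x s) (vel s) (vel s))‖ ≤ K * ‖vel s‖ ^ 2
      rw [norm_neg, sq]
      calc ‖OpensChart.christoffel gU G (x s) (vel s) (vel s)‖ ≤ 3 * Λr * ‖vel s‖ * ‖vel s‖ :=
            hΓ (x s) (vel s) (vel s)
        _ ≤ K * (‖vel s‖ * ‖vel s‖) := by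
            rw [← mul_assoc]; gcongr; linarith)
    (by rw [hxt0, sub_zero]; exact hxT)
  -- the boost parameter `u = ‖x'(t)‖` and its lower bound
  set u : ℝ := ‖vel t‖ with hu
  have hTle : T ≤ sSup dom := le_csSup hbdd hTdom
  have hTt : 0 < T - t := by linarith
  have hbt : 0 < sSup dom - t := by linarith
  have hu_lb : c₁ / (sSup dom - t) ≤ u := by
    calc c₁ / (sSup dom - t) ≤ c₁ / (T - t) := div_le_div_of_nonneg_left hc₁pos.le hTt (by linarith)
      _ = (1 - Real.exp (-(K * (r₀ / 2)))) / (K * (T - t)) := by rw [hc₁, div_div]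
      _ ≤ u := hspeed
  have hupos : 0 < u := lt_of_lt_of_le (div_pos hc₁pos hbt) hu_lb
  have hCu : (C * (sSup dom - t))⁻¹ ≤ u := by
    refine le_trans ?_ hu_lb
    rw [div_eq_mul_inv, ← inv_inv c₁, ← mul_inv]
    exact inv_anti₀ (mul_pos (inv_pos.2 hc₁pos) hbt) (mul_le_mul_of_nonneg_right hc₁_le hbt.le)
  -- the adapted frame in the chart at `x t`
  set ξ : E4 := vel t with hξ
  set dΨ := mfderiv 𝓘(ℝ, E4) (𝓡 4) Ψ (x t) with hdΨ
  have hvelt : (dΨ ξ : E4) = (velocity (𝓡 4) γ t : E4) := hvel t htO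
  have hGapp : ∀ a b : E4, gU.val (x t) a b = G (x t) a b := fun a b ↦ congrArg (fun B ↦ B a b) (hG (x t))
  have hGsym : ∀ a b : E4, G (x t) a b = G (x t) b a := by
    intro a b
    rw [← hGapp, ← hGapp]
    exact gU.symm (x t) a b
  have key_val : ∀ a b : E4, 𝒟.metric.val (γ t) (dΨ a) (dΨ b) = G (x t) a b := by
    intro a b
    rw [← hGapp]
    have h3 : ∀ p, Ψ (x t) = p → 𝒟.metric.val p (dΨ a) (dΨ b) = gU.val (x t) a b := by
      rintro p rfl; rfl
    exact h3 _ (hxΨ t htO.2)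
  have hnullξ : G (x t) ξ ξ = 0 := by
    rw [← key_val, hvelt]
    exact (hnull t ht).1.1
  have hξ0 : ξ ≠ 0 := by
    intro h
    have hz : dΨ ξ = 0 := by rw [h]; exact map_zero dΨ
    apply (hnull t ht).1.2
    have e := hvelt
    rw [hz] at e
    exact e.symm
  obtain ⟨n, e₂, e₃, hnn, hℓn, h22, h33, h23, hℓ2, hℓ3, hn2', hn3, hnℓ, he2, he3⟩ :=
    adaptedNullFrame_of_pin (G (x t)) hGsym (hpinG (x t)) hnullξ hξ0
  -- push the frame forward by `dΨ`
  set fh : Fin 4 → E4 := ![ξ, n, e₂, e₃] with hfh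
  refine ⟨fun i ↦ (dΨ (fh i) : E4), ⟨?_, ?_, ?_, ?_, ?_, ?_, ?_, ?_, ?_, ?_, ?_⟩, u, hCu, fun a b c e ↦ ?_⟩
  · show (dΨ ξ : E4) = _
    exact hvelt
  · show 𝒟.metric.val (γ t) (dΨ ξ) (dΨ ξ) = 0
    rw [key_val]; exact hnullξ
  · show 𝒟.metric.val (γ t) (dΨ n) (dΨ n) = 0
    rw [key_val]; exact hnn
  · show 𝒟.metric.val (γ t) (dΨ ξ) (dΨ n) = -1
    rw [key_val]; exact hℓn
  · show 𝒟.metric.val (γ t) (dΨ e₂) (dΨ e₂) = 1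
    rw [key_val]; exact h22
  · show 𝒟.metric.val (γ t) (dΨ e₃) (dΨ e₃) = 1
    rw [key_val]; exact h33
  · show 𝒟.metric.val (γ t) (dΨ e₂) (dΨ e₃) = 0
    rw [key_val]; exact h23
  · show 𝒟.metric.val (γ t) (dΨ ξ) (dΨ e₂) = 0
    rw [key_val]; exact hℓ2
  · show 𝒟.metric.val (γ t) (dΨ ξ) (dΨ e₃) = 0
    rw [key_val]; exact hℓ3
  · show 𝒟.metric.val (γ t) (dΨ n) (dΨ e₂) = 0
    rw [key_val]; exact hn2'
  · show 𝒟.metric.val (γ t) (dΨ n) (dΨ e₃) = 0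
    rw [key_val]; exact hn3
  · -- the weight table
    have hf0 : fh 0 = ξ := rfl
    have hf1 : fh 1 = n := rfl
    have hcurv : 𝒟.metric.val (γ t)
        (CovariantDerivative.curvature 𝒟.metric.leviCivita (γ t) (dΨ (fh a)) (dΨ (fh b)) (dΨ (fh c)))
        (dΨ (fh e)) = gU.val (x t) (gU.riemann (x t) (fh a) (fh b) (fh c)) (fh e) := by
      have h3 : ∀ p, Ψ (x t) = p → 𝒟.metric.val p
          (CovariantDerivative.curvature 𝒟.metric.leviCivita p (dΨ (fh a)) (dΨ (fh b)) (dΨ (fh c)))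
          (dΨ (fh e)) = gU.val (x t) (gU.riemann (x t) (fh a) (fh b) (fh c)) (fh e) := by
        rintro p rfl
        exact val_riemann_immersionChart 𝒟.toSpacetime Uo Ψ hΨs hΨ' rfl (x t) (fh a) (fh b) (fh c) (fh e)
      exact h3 _ (hxΨ t htO.2)
    show |𝒟.metric.val (γ t)
        (CovariantDerivative.curvature 𝒟.metric.leviCivita (γ t) (dΨ (fh a)) (dΨ (fh b)) (dΨ (fh c)))
        (dΨ (fh e))| ≤ _
    rw [hcurv]
    have hb := hRb (x t) (fh a) (fh b) (fh c) (fh e)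
    have h0' : ∀ i : Fin 4, i = 0 → ‖fh i‖ ≤ u := by
      rintro i rfl
      show ‖ξ‖ ≤ ‖vel t‖
      exact le_rfl
    have h1' : ∀ i : Fin 4, i = 1 → ‖fh i‖ ≤ 24 / u := by
      rintro i rfl
      rw [hf1, le_div_iff₀ hupos]
      exact hnℓ
    have h2' : ∀ i : Fin 4, i ≠ 0 → i ≠ 1 → ‖fh i‖ ≤ 74 := by
      intro i hi0 hi1
      fin_cases i
      · exact absurd rfl hi0
      · exact absurd rfl hi1
      · exact he2
      · exact he3
    have htab := table_bound hupos hCR0 (fun i ↦ ‖fh i‖) (fun i ↦ norm_nonneg _) h0' h1' h2' a b c e hb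
    refine htab.trans ?_
    exact mul_le_mul_of_nonneg_right hCR_le (zpow_pos hupos _).le

end Summit.FinalStateConjecture.FinalStateConjecture.Theorems.PhotonSphereChannels.TameCensorshipUnwind

end
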